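import Summits.AnomalousDissipation.AnomalousDissipation.Theorems.BaireTransferRobustLoudUpgradeStubSteadyPersist
import Literature.Analysis.FluidPDE.SteadyNSLatticePersistenceDrift
import Literature.Analysis.FluidPDE.BilinearFixedPoint

/-!
# Stub `stub_leafSteadySmallExists` of the line `malkin-cone-group-orbits` (crux stmt-AnomalousDissipation-1144,
# companion lead c1): small-data classical steady states of PRESCRIBED MEAN on the Fourier lattice

Temam 1979 Ch. II §1 Thm 1.3 run in a conserved-mean leaf `{⨍ u = m}` of `NS_ν(f_c)` on `T³`: the drifted
steady system `−νΔṽ + (m·∇)ṽ + (ṽ·∇)ṽ + ∇q = f_c`, `v = m + ṽ`, is solved by CONTRACTION in the lattice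
state space `W ⊂ ℓ²(ℤ³; ℂ³)` of `Literature/Analysis/FluidPDE/SteadyNSLatticePersistence(Drift).lean`: with
the inverse `R` of the drifted Stokes multiplier `4π²ν + 2πi(k·m)/|k|²` (modulus `≥ 4π²ν` uniformly in
`m`, §1), `x = R F_c − R B(x,x)` is a quadratic fixed-point problem (`BilinearFixedPoint`) with datum
`‖R F_c‖ ≤ ‖f_c‖₂/(4π²ν)`; its solution is rapidly decaying (`rapidDecay_of_perturbed_eq`), synthesises a
classical steady state of mean `m` (`steadyState_of_fourier_drift`), and is born with
`‖Δv‖₂² = 16π⁴‖x‖² ≤ 4‖f_c‖₂²/ν²`, `‖∇v‖₂² ≤ 4π²‖x‖² ≤ ‖f_c‖₂²/ν²` (Parseval).  Pure proof file.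
-/

-- `Summit.<Summit>.<Problem>` is the tree's mandated summit-side namespace (CONVENTIONS §2); for this
-- single-conjunct summit the two coincide, so the duplicate is deliberate.
set_option linter.dupNamespace false

noncomputable section

open scoped BigOperators Topology ENNReal NNReal InnerProductSpace ComplexConjugate
open Filter Set Function TopologicalSpace MeasureTheory UnitAddTorus

namespace Summit.AnomalousDissipation.AnomalousDissipation.Theorems.RobustLoudUpgrade.LaminarCorner

open Literature.Analysis.FunctionSpaces Literature.Analysis.FunctionSpaces.Torus
open Literature.Analysis.FunctionSpaces.EuclideanSpace
open Literature.Analysis.FluidPDE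
open Literature.Analysis.FluidPDE.ScalarFourier
open Literature.Analysis.FluidPDE.SteadyLattice
open Literature.Analysis.FluidPDE.SteadyLatticeDrift
open Summit.AnomalousDissipation.AnomalousDissipation.Theses.BaireTransfer
open Summit.AnomalousDissipation.AnomalousDissipation.Theorems.RobustLoudUpgrade
open Summit.AnomalousDissipation.AnomalousDissipation.Theorems.RobustLoudUpgrade.SteadyPersist

/-! ## §1 The inverse of the drifted Stokes multiplier on the state space `W` -/

section InverseMultiplier

variable {W : Submodule ℝ (lp (fun _ : Fin 3 → ℤ => EuclideanSpace ℂ (Fin 3)) 2)} (hW : ∀ x : (lp (fun _ : Fin 3 →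
    ℤ => EuclideanSpace ℂ (Fin 3)) 2), x ∈ W ↔ (((x : (Fin 3 → ℤ) → (EuclideanSpace ℂ (Fin 3))) : (Fin 3 → ℤ) →
    EuclideanSpace ℂ (Fin 3)) 0 = 0 ∧ (∀ kk : Fin 3 → ℤ, (∑ jj : Fin 3, ((kk jj : ℤ) : ℂ) * (((x : (Fin 3 → ℤ) →
    (EuclideanSpace ℂ (Fin 3))) : (Fin 3 → ℤ) → EuclideanSpace ℂ (Fin 3)) kk) jj) = 0) ∧ IsConjSymm ((x : (Fin 3 → ℤ)
    → (EuclideanSpace ℂ (Fin 3))) : (Fin 3 → ℤ) → EuclideanSpace ℂ (Fin 3))))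
include hW

/-- **The inverse drifted Stokes multiplier on `W`**: for `ν > 0` and a real drift vector `M`
(`conj M = M`) the symbol `t(k) = 4π²ν + 2πi(k·M)/|k|²` has real part `4π²ν`, so `r = 1/t` is a bounded
(`|r| ≤ 1/(4π²ν)`), conjugate-odd multiplier: there is an `ℝ`-linear `R : W → W` with
`‖R y‖ ≤ ‖y‖/(4π²ν)` and `4π²ν (Ry)(k) + 2πi(k·M) (Ry)̌(k) = y(k)` (i.e. `T ∘ R = id` for the drifted
Stokes operator `T = 4π²ν + D_M` of `SteadyLatticeDrift.exists_drift`). [folklore] -/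
theorem exists_invMultiplier {ν : ℝ} (hν : 0 < ν) {M : (EuclideanSpace ℂ (Fin 3))} (hM : conjVec M = M) :
    ∃ R : W →ₗ[ℝ] W, (∀ y : W, ‖R y‖ ≤ (4 * Real.pi ^ 2 * ν)⁻¹ * ‖y‖) ∧
      ∀ (y : W) (k : Fin 3 → ℤ), (((4 * Real.pi ^ 2 * ν : ℝ)) : ℂ) • ((R y : W) : (lp (fun _ : Fin 3 →
          ℤ => EuclideanSpace ℂ (Fin 3)) 2)) k +
        (2 * Real.pi * Complex.I * (∑ jj : Fin 3, ((k jj : ℤ) : ℂ) * M jj)) • ((fun mm : Fin 3 →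
          ℤ => (((freqNormSq mm)⁻¹ : ℝ) : ℂ)) • (((R y : W) : (lp (fun _ : Fin 3 → ℤ => EuclideanSpace ℂ (Fin 3))
          2)) : (Fin 3 → ℤ) → EuclideanSpace ℂ (Fin 3))) k =
        ((y : W) : (lp (fun _ : Fin 3 → ℤ => EuclideanSpace ℂ (Fin 3)) 2)) k := by
  set cν : ℝ := 4 * Real.pi ^ 2 * ν with hcν
  have hc0 : 0 < cν := by positivity
  -- the symbol and its inverse
  set t : (Fin 3 → ℤ) → ℂ := fun k => (cν : ℂ) + (2 * Real.pi * Complex.I * (∑ jj : Fin 3, ((k jj : ℤ) : ℂ) *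
    M jj)) * (((freqNormSq k)⁻¹ : ℝ) : ℂ) with ht
  have hreal : ∀ k : Fin 3 → ℤ, ((∑ jj : Fin 3, ((k jj : ℤ) : ℂ) * M jj)).im = 0 := fun k => by
    have h := conj_kdot k M
    rw [hM] at h
    exact Complex.conj_eq_iff_im.1 h
  have htre : ∀ k, (t k).re = cν := fun k => by
    have hz := hreal k
    simp only [ht]
    generalize (∑ jj : Fin 3, ((k jj : ℤ) : ℂ) * M jj) = q at hz
    simp [Complex.mul_re, Complex.mul_im, hz]
  have htn : ∀ k, cν ≤ ‖t k‖ := fun k => by rw [← htre k]; exact Complex.re_le_norm _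
  have ht0 : ∀ k, t k ≠ 0 := fun k h => by
    have := htn k; rw [h, norm_zero] at this; linarith
  have htconj : ∀ k, t (-k) = conj (t k) := fun k => by
    simp only [ht]
    rw [map_add, map_mul, Complex.conj_ofReal, Complex.conj_ofReal, ← driftCoeff_neg k hM, freqNormSq_neg]
  have hrn : ∀ k, ‖(t k)⁻¹‖ ≤ cν⁻¹ := fun k => by rw [norm_inv]; exact inv_anti₀ hc0 (htn k)
  -- the raw map
  set g : (lp (fun _ : Fin 3 → ℤ => EuclideanSpace ℂ (Fin 3)) 2) → (Fin 3 → ℤ) → (EuclideanSpace ℂ (Fin 3)) :=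
    fun x k => (t k)⁻¹ • (x : (Fin 3 → ℤ) → (EuclideanSpace ℂ (Fin 3))) k with hg
  have hbound : ∀ x : (lp (fun _ : Fin 3 → ℤ => EuclideanSpace ℂ (Fin 3)) 2), ∑' k, ‖g x k‖ₑ ^ 2 ≤
      (ENNReal.ofReal cν⁻¹ * ‖x‖ₑ) ^ 2 := by
    intro x
    calc ∑' k, ‖g x k‖ₑ ^ 2
        ≤ ∑' k, (ENNReal.ofReal cν⁻¹ * ‖(x : (Fin 3 → ℤ) → (EuclideanSpace ℂ (Fin 3))) k‖ₑ) ^ 2 :=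
          ENNReal.tsum_le_tsum fun k => by
            refine pow_le_pow_left' ?_ 2
            rw [← ofReal_norm, ← ofReal_norm, ← ENNReal.ofReal_mul (inv_nonneg.2 hc0.le)]
            refine ENNReal.ofReal_le_ofReal ?_
            simp only [hg]
            rw [norm_smul]
            exact mul_le_mul_of_nonneg_right (hrn k) (norm_nonneg _)
      _ = ENNReal.ofReal cν⁻¹ ^ 2 * ∑' k, ‖(x : (Fin 3 → ℤ) → (EuclideanSpace ℂ (Fin 3))) k‖ₑ ^ 2 := by
          rw [← ENNReal.tsum_mul_left]; exact tsum_congr fun k => by ring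
      _ = (ENNReal.ofReal cν⁻¹ * ‖x‖ₑ) ^ 2 := by rw [← l2_enorm_sq_eq_tsum, mul_pow]
  have hmem : ∀ x : (lp (fun _ : Fin 3 → ℤ => EuclideanSpace ℂ (Fin 3)) 2), Memℓp (g x) 2 := fun x =>
    memℓp_two_of_tsum_ne_top (ne_top_of_le_ne_top
      (ENNReal.pow_ne_top (ENNReal.mul_ne_top ENNReal.ofReal_ne_top enorm_ne_top)) (hbound x))
  have hV : ∀ x : W, ((g (x : (lp (fun _ : Fin 3 → ℤ => EuclideanSpace ℂ (Fin 3)) 2)) : (Fin 3 → ℤ) →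
      (EuclideanSpace ℂ (Fin 3))) 0 = 0 ∧
      (∀ kk : Fin 3 → ℤ, (∑ jj : Fin 3, ((kk jj : ℤ) : ℂ) * ((g (x : (lp (fun _ : Fin 3 → ℤ => EuclideanSpace ℂ
          (Fin 3)) 2)) : (Fin 3 → ℤ) → (EuclideanSpace ℂ (Fin 3))) kk) jj) = 0) ∧
      IsConjSymm (g (x : (lp (fun _ : Fin 3 → ℤ => EuclideanSpace ℂ (Fin 3)) 2)) : (Fin 3 → ℤ) → (EuclideanSpace ℂ
          (Fin 3)))) := by
    intro x
    refine ⟨?_, fun k => ?_, fun k => ?_⟩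
    · simp only [hg]
      rw [W_zero hW x, smul_zero]
    · simp only [hg]
      rw [kdot_smul, W_trans hW x k, mul_zero]
    · simp only [hg]
      rw [htconj, ← map_inv₀, W_conj hW x k, conjVec_smul]
  set T : W → W := fun x => ⟨⟨g (x : (lp (fun _ : Fin 3 → ℤ => EuclideanSpace ℂ (Fin 3)) 2)), hmem _⟩,
    (hW _).2 (hV x)⟩ with hT
  have hTcoe : ∀ x : W, (((T x : W) : (lp (fun _ : Fin 3 → ℤ => EuclideanSpace ℂ (Fin 3)) 2)) : (Fin 3 → ℤ) →
      (EuclideanSpace ℂ (Fin 3))) = g (x : (lp (fun _ : Fin 3 → ℤ => EuclideanSpace ℂ (Fin 3)) 2)) := fun x => rfl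
  have hadd : ∀ x y : W, T (x + y) = T x + T y := by
    intro x y
    refine Subtype.ext (lp.ext (funext fun k => ?_))
    change g ((x + y : W) : (lp (fun _ : Fin 3 → ℤ => EuclideanSpace ℂ (Fin 3)) 2)) k = g (x : (lp (fun _ : Fin 3 →
        ℤ => EuclideanSpace ℂ (Fin 3)) 2)) k + g (y : (lp (fun _ : Fin 3 → ℤ => EuclideanSpace ℂ (Fin 3)) 2)) k
    simp only [hg]
    rw [show (((x + y : W) : (lp (fun _ : Fin 3 → ℤ => EuclideanSpace ℂ (Fin 3)) 2)) : (Fin 3 → ℤ) →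
        (EuclideanSpace ℂ (Fin 3))) = ((x : (lp (fun _ : Fin 3 → ℤ => EuclideanSpace ℂ (Fin 3)) 2)) : (Fin 3 → ℤ) →
        (EuclideanSpace ℂ (Fin 3))) +
      ((y : (lp (fun _ : Fin 3 → ℤ => EuclideanSpace ℂ (Fin 3)) 2)) : (Fin 3 → ℤ) → (EuclideanSpace ℂ (Fin 3)))
          from rfl, Pi.add_apply, smul_add]
  have hsmul : ∀ (a : ℝ) (x : W), T (a • x) = a • T x := by
    intro a x
    refine Subtype.ext (lp.ext (funext fun k => ?_))
    change g ((a • x : W) : (lp (fun _ : Fin 3 → ℤ => EuclideanSpace ℂ (Fin 3)) 2)) k = (a • g (x : (lp (fun _ :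
        Fin 3 → ℤ => EuclideanSpace ℂ (Fin 3)) 2))) k
    simp only [hg, Pi.smul_apply]
    rw [show (((a • x : W) : (lp (fun _ : Fin 3 → ℤ => EuclideanSpace ℂ (Fin 3)) 2)) : (Fin 3 → ℤ) →
        (EuclideanSpace ℂ (Fin 3))) = a • ((x : (lp (fun _ : Fin 3 → ℤ => EuclideanSpace ℂ (Fin 3)) 2)) : (Fin 3 →
        ℤ) → (EuclideanSpace ℂ (Fin 3))) from rfl,
      Pi.smul_apply, smul_comm]
  have hnorm : ∀ x : W, ‖T x‖ ≤ cν⁻¹ * ‖x‖ := by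
    intro x
    rw [← norm_coeW]
    refine l2_norm_le_of_tsum_le _ (by positivity) ?_
    rw [hTcoe, ENNReal.ofReal_mul (inv_nonneg.2 hc0.le), ofReal_norm]
    exact hbound _
  refine ⟨{ toFun := T, map_add' := hadd, map_smul' := hsmul }, hnorm, fun y k => ?_⟩
  change (cν : ℂ) • g (y : (lp (fun _ : Fin 3 → ℤ => EuclideanSpace ℂ (Fin 3)) 2)) k + (2 * Real.pi * Complex.I *
      (∑ jj : Fin 3, ((k jj : ℤ) : ℂ) * M jj)) • ((fun mm : Fin 3 → ℤ => (((freqNormSq mm)⁻¹ : ℝ) : ℂ)) • (g (y :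
      (lp (fun _ : Fin 3 → ℤ => EuclideanSpace ℂ (Fin 3)) 2)) : (Fin 3 → ℤ) → EuclideanSpace ℂ (Fin 3))) k = _
  rw [cf_apply]
  simp only [hg]
  rw [smul_smul, smul_smul, smul_smul, ← add_smul]
  calc _ = (t k * (t k)⁻¹) • ((y : W) : (lp (fun _ : Fin 3 → ℤ => EuclideanSpace ℂ (Fin 3)) 2)) k := by
          congr 1; simp only [ht]; ring
    _ = _ := by rw [mul_inv_cancel₀ (ht0 k), one_smul]

end InverseMultiplier

/-! ## §2 The contraction in a leaf and the registered stub -/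

/-- **Stub `stub_leafSteadySmallExists`** (Temam 1979 Ch. II §1 Thm 1.3 in a conserved-mean leaf, by
contraction on the Fourier lattice): there is `κ > 0` such that for every finite family `S`, every `c ∈ P_S`,
every `ν > 0` with `‖f_c‖₂ ≤ κ ν²` and EVERY mean `m ∈ ℝ³`, `NS_ν(f_c)` on `T³` has a classical steady state `v`
of mean `m` with `‖Δv‖₂² ≤ 4‖f_c‖₂²/ν²` and `‖∇v‖₂² ≤ ‖f_c‖₂²/ν²`. [folklore] -/
theorem stub_leafSteadySmallExists :
    ∃ κ : ℝ, 0 < κ ∧ ∀ (S : Finset (Fin 3 → ℤ)) (c : Coeff S) (ν : ℝ) (m : EuclideanSpace ℝ (Fin 3)),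
      0 < ν → Real.sqrt (∫ x, ‖force S c x‖ ^ 2) ≤ κ * ν ^ 2 →
      ∃ (v : UnitAddTorus (Fin 3) → EuclideanSpace ℝ (Fin 3)) (q : UnitAddTorus (Fin 3) → ℝ),
        Torus.IsSteadyNSState ν (force S c) v q ∧ (∫ x, v x) = m ∧
        (∫ x, ‖laplacian v x‖ ^ 2) ≤ 4 * (∫ x, ‖force S c x‖ ^ 2) / ν ^ 2 ∧
        gradNormSq v ≤ (∫ x, ‖force S c x‖ ^ 2) / ν ^ 2 := by
  -- §1 the state space and the bilinear map (independent of the force), the constant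
  obtain ⟨W, hW, hWc⟩ := exists_space
  haveI : CompleteSpace W := completeSpace_W hWc
  obtain ⟨B, hB, hBb⟩ := exists_bilinear hW
  obtain ⟨β, hβ, hBβ⟩ := hBb.bound
  refine ⟨Real.pi ^ 4 / β, by positivity, ?_⟩
  intro S c ν m hν hsmall
  obtain ⟨Fm, hFm⟩ := exists_forceMap (S := S) hW
  set M : (EuclideanSpace ℂ (Fin 3)) := complexify m with hMdef
  have hM : conjVec M = M := conjVec_complexify m
  set cν : ℝ := 4 * Real.pi ^ 2 * ν with hcν
  have hc0 : 0 < cν := by positivity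
  obtain ⟨R, hRn, hRco⟩ := exists_invMultiplier hW hν hM
  -- §2 Parseval: `‖F_c‖_W = ‖f_c‖₂ ≤ κ ν²`
  set F : ℝ := ‖Fm c‖ with hFdef
  have hF0 : 0 ≤ F := norm_nonneg _
  have hFsq : F ^ 2 = ∫ x, ‖force S c x‖ ^ 2 := by
    rw [hFdef, ← norm_coeW, l2_norm_sq_eq_tsum, hFm, integral_norm_sq_eq_tsum ((isSmooth_force' c).memLp 2)]
  have hFle : F ≤ Real.pi ^ 4 / β * ν ^ 2 := by
    have e : F = Real.sqrt (∫ x, ‖force S c x‖ ^ 2) := by rw [← hFsq, Real.sqrt_sq hF0]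
    rw [e]; exact hsmall
  -- §3 the contraction `x = R F_c − R B(x,x)`
  set y : W := R (Fm c) with hydef
  set B' : W → W → W := fun x x' => -R (B x x') with hB'def
  set η : ℝ := cν⁻¹ * β with hηdef
  have hη : 0 ≤ η := by positivity
  have hB' : ∀ x x' : W, ‖B' x x'‖ ≤ η * ‖x‖ * ‖x'‖ := fun x x' => by
    rw [hB'def, norm_neg]
    calc ‖R (B x x')‖ ≤ cν⁻¹ * ‖B x x'‖ := hRn _
      _ ≤ cν⁻¹ * (β * ‖x‖ * ‖x'‖) := mul_le_mul_of_nonneg_left (hBβ x x') (inv_nonneg.2 hc0.le)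
      _ = η * ‖x‖ * ‖x'‖ := by rw [hηdef]; ring
  have hadd₁ : ∀ x x' z : W, B' (x + x') z = B' x z + B' x' z := fun x x' z => by
    simp only [hB'def]
    rw [show B (x + x') z = B x z + B x' z from hBb.add_left x x' z, map_add, neg_add]
  have hadd₂ : ∀ x z z' : W, B' x (z + z') = B' x z + B' x z' := fun x z z' => by
    simp only [hB'def]
    rw [show B x (z + z') = B x z + B x z' from hBb.add_right x z z', map_add, neg_add]
  have hyn : ‖y‖ ≤ cν⁻¹ * F := hRn _
  have hy4 : 4 * η * ‖y‖ < 1 := by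
    have h1 : 4 * η * ‖y‖ ≤ 4 * η * (cν⁻¹ * F) := mul_le_mul_of_nonneg_left hyn (by positivity)
    have h2 : 4 * η * (cν⁻¹ * F) ≤ 4 * η * (cν⁻¹ * (Real.pi ^ 4 / β * ν ^ 2)) :=
      mul_le_mul_of_nonneg_left (mul_le_mul_of_nonneg_left hFle (inv_nonneg.2 hc0.le)) (by positivity)
    have h3 : 4 * η * (cν⁻¹ * (Real.pi ^ 4 / β * ν ^ 2)) = 1 / 4 := by
      rw [hηdef, hcν]; field_simp
    linarith
  obtain ⟨x₀, hx₀n, hx₀eq⟩ := exists_fixedPoint_of_bilinear hη hB' hadd₁ hadd₂ hy4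
  have hx₀F : ‖x₀‖ ≤ 2 * (cν⁻¹ * F) := hx₀n.trans (mul_le_mul_of_nonneg_left hyn (by norm_num))
  -- §4 the drifted steady lattice equations of `x₀`
  have hx₀R : x₀ = R (Fm c - B x₀ x₀) := by
    rw [map_sub, sub_eq_add_neg]
    conv_lhs => rw [hx₀eq]
  have hxeq : ∀ k : Fin 3 → ℤ, (((4 * Real.pi ^ 2 * ν : ℝ)) : ℂ) • ((x₀ : W) : (lp (fun _ : Fin 3 → ℤ =>
      EuclideanSpace ℂ (Fin 3)) 2)) k +
      (2 * Real.pi * Complex.I * (∑ jj : Fin 3, ((k jj : ℤ) : ℂ) * M jj)) • ((fun mm : Fin 3 → ℤ => (((freqNormSq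
          mm)⁻¹ : ℝ) : ℂ)) • (((x₀ : W) : (lp (fun _ : Fin 3 → ℤ => EuclideanSpace ℂ (Fin 3)) 2)) : (Fin 3 → ℤ) →
          EuclideanSpace ℂ (Fin 3))) k +
      Torus.lerayCoeff k (WithLp.toLp 2 (fun pp : Fin 3 => transportSym (fun jj mm => ((fun mm : Fin 3 → ℤ =>
          (((freqNormSq mm)⁻¹ : ℝ) : ℂ)) • (((x₀ : W) : (lp (fun _ : Fin 3 → ℤ => EuclideanSpace ℂ (Fin 3)) 2)) :
          (Fin 3 → ℤ) → EuclideanSpace ℂ (Fin 3))) mm jj) (fun mm => ((fun mm : Fin 3 → ℤ => (((freqNormSq mm)⁻¹ :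
          ℝ) : ℂ)) • (((x₀ : W) : (lp (fun _ : Fin 3 → ℤ => EuclideanSpace ℂ (Fin 3)) 2)) : (Fin 3 → ℤ) →
          EuclideanSpace ℂ (Fin 3))) mm pp) k) : EuclideanSpace ℂ (Fin 3)) =
      mFourierCoeff (complexify ∘ force S c) k := by
    intro k
    have h1 := hRco (Fm c - B x₀ x₀) k
    rw [← hx₀R, coeW_sub, hFm, hB, Pi.sub_apply] at h1
    rw [h1, sub_add_cancel]
  -- §5 regularity: `x̌₀` is rapidly decaying
  have hxr : RapidDecay ((fun mm : Fin 3 → ℤ => (((freqNormSq mm)⁻¹ : ℝ) : ℂ)) • (((x₀ : W) : (lp (fun _ : Fin 3 →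
      ℤ => EuclideanSpace ℂ (Fin 3)) 2)) : (Fin 3 → ℤ) → EuclideanSpace ℂ (Fin 3))) :=
    rapidDecay_of_perturbed_eq hν (rapidDecay_single M) (single_transversal M) (x₀ : (lp (fun _ : Fin 3 → ℤ =>
        EuclideanSpace ℂ (Fin 3)) 2)) (W_trans hW x₀)
      (fun s => tsum_weight_mul_enorm_ne_top_of_rapidDecay (rapidDecay_forceCoeff c) s)
      (fun k => by rw [leray_nl_linearised_single M (W_trans hW x₀) k]; exact hxeq k)
  -- §6 synthesis of a classical steady state of mean `m`
  have heqb : ∀ k : Fin 3 → ℤ, (((ν * (4 * Real.pi ^ 2 * freqNormSq k)) : ℝ) : ℂ) • ((fun mm : Fin 3 → ℤ =>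
      (((freqNormSq mm)⁻¹ : ℝ) : ℂ)) • (((x₀ : W) : (lp (fun _ : Fin 3 → ℤ => EuclideanSpace ℂ (Fin 3)) 2)) :
      (Fin 3 → ℤ) → EuclideanSpace ℂ (Fin 3))) k +
      (2 * Real.pi * Complex.I * (∑ jj : Fin 3, ((k jj : ℤ) : ℂ) * M jj)) • ((fun mm : Fin 3 → ℤ => (((freqNormSq
          mm)⁻¹ : ℝ) : ℂ)) • (((x₀ : W) : (lp (fun _ : Fin 3 → ℤ => EuclideanSpace ℂ (Fin 3)) 2)) : (Fin 3 → ℤ) →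
          EuclideanSpace ℂ (Fin 3))) k +
      Torus.lerayCoeff k (WithLp.toLp 2 (fun pp : Fin 3 => transportSym (fun jj mm => ((fun mm : Fin 3 → ℤ =>
          (((freqNormSq mm)⁻¹ : ℝ) : ℂ)) • (((x₀ : W) : (lp (fun _ : Fin 3 → ℤ => EuclideanSpace ℂ (Fin 3)) 2)) :
          (Fin 3 → ℤ) → EuclideanSpace ℂ (Fin 3))) mm jj) (fun mm => ((fun mm : Fin 3 → ℤ => (((freqNormSq mm)⁻¹ :
          ℝ) : ℂ)) • (((x₀ : W) : (lp (fun _ : Fin 3 → ℤ => EuclideanSpace ℂ (Fin 3)) 2)) : (Fin 3 → ℤ) →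
          EuclideanSpace ℂ (Fin 3))) mm pp) k) : EuclideanSpace ℂ (Fin 3)) =
      mFourierCoeff (complexify ∘ force S c) k := fun k => by
    rw [← smul_eq_weight_smul_cf (W_zero hW x₀) k]; exact hxeq k
  obtain ⟨v, q, hst, hv, hvc⟩ := steadyState_of_fourier_drift (isSmooth_force' c) (isDivFree_force' c)
    (hasZeroMean_force' c) hxr (isConjSymm_cf (W_conj hW x₀)) (cf_transversal (W_trans hW x₀)) (cf_zero _) hM heqb
  have hx0sq : ‖x₀‖ ^ 2 ≤ (2 * (cν⁻¹ * F)) ^ 2 := pow_le_pow_left₀ (norm_nonneg _) hx₀F 2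
  refine ⟨v, q, hst, ?_, ?_, ?_⟩
  · -- the mean
    have h0 : mFourierCoeff (complexify ∘ v) 0 = M := by rw [hvc]; exact add_single_apply_zero (cf_zero _) M
    rw [SteadyLatticeDrift.mFourierCoeff_complexify_zero hv] at h0
    exact complexify_injective h0
  · -- `‖Δv‖₂² = 16π⁴ ‖x₀‖²`
    have hpt : ∀ k : Fin 3 → ℤ, ‖mFourierCoeff (complexify ∘ laplacian v) k‖ ^ 2 =
        (4 * Real.pi ^ 2) ^ 2 * ‖((x₀ : W) : (lp (fun _ : Fin 3 → ℤ => EuclideanSpace ℂ (Fin 3)) 2)) k‖ ^ 2 := by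
      intro k
      rw [mFourierCoeff_complexify_laplacian hv k, hvc, norm_neg, Pi.add_apply, ← mul_pow]
      congr 1
      by_cases hk : k = 0
      · subst hk
        rw [W_zero hW x₀, freqNormSq_zero, mul_zero, Complex.ofReal_zero, zero_smul, norm_zero, mul_zero]
      · have hf : freqNormSq k ≠ 0 := ne_of_gt (lt_of_lt_of_le one_pos (one_le_freqNormSq' hk))
        rw [Pi.single_eq_of_ne hk, add_zero, cf_apply, smul_smul, ← Complex.ofReal_mul, mul_assoc,
          mul_inv_cancel₀ hf, mul_one, norm_smul, Complex.norm_real, Real.norm_of_nonneg (by positivity)]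
    rw [integral_norm_sq_eq_tsum (hv.laplacian.memLp 2)]
    simp_rw [hpt]
    rw [tsum_mul_left, ← l2_norm_sq_eq_tsum, norm_coeW, ← hFsq]
    calc (4 * Real.pi ^ 2) ^ 2 * ‖x₀‖ ^ 2 ≤ (4 * Real.pi ^ 2) ^ 2 * (2 * (cν⁻¹ * F)) ^ 2 :=
          mul_le_mul_of_nonneg_left hx0sq (by positivity)
      _ = 4 * F ^ 2 / ν ^ 2 := by rw [hcν]; field_simp; ring
  · -- `‖∇v‖₂² ≤ 4π² ‖x₀‖²`
    have h := tsum_freqNormSq_mul_enorm_sq_mFourierCoeff_complexify hv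
    rw [hvc] at h
    have hle : ∑' k, ENNReal.ofReal (freqNormSq k) * ‖(((fun mm : Fin 3 → ℤ => (((freqNormSq mm)⁻¹ : ℝ) : ℂ)) •
        (((x₀ : W) : (lp (fun _ : Fin 3 → ℤ => EuclideanSpace ℂ (Fin 3)) 2)) : (Fin 3 → ℤ) →
        EuclideanSpace ℂ (Fin 3))) + (Pi.single (0 : Fin 3 → ℤ) M : (Fin 3 → ℤ) → (EuclideanSpace ℂ (Fin 3)))) k‖ₑ ^ 2
        ≤ ‖((x₀ : W) : (lp (fun _ : Fin 3 → ℤ => EuclideanSpace ℂ (Fin 3)) 2))‖ₑ ^ 2 := by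
      rw [l2_enorm_sq_eq_tsum]
      refine ENNReal.tsum_le_tsum fun k => ?_
      by_cases hk : k = 0
      · subst hk; simp [freqNormSq_zero]
      · rw [Pi.add_apply, Pi.single_eq_of_ne hk, add_zero]; exact freq_mul_enorm_cf_sq_le _ k
    rw [h, ← ofReal_norm, ← ENNReal.ofReal_pow (norm_nonneg _), ENNReal.ofReal_le_ofReal_iff (sq_nonneg _),
      norm_coeW] at hle
    have hpi : (0 : ℝ) < 4 * Real.pi ^ 2 := by positivity
    rw [inv_mul_le_iff₀ hpi] at hle
    have hπ1 : (1 : ℝ) ≤ Real.pi ^ 2 := by nlinarith [Real.pi_gt_three]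
    rw [← hFsq]
    calc gradNormSq v ≤ 4 * Real.pi ^ 2 * ‖x₀‖ ^ 2 := hle
      _ ≤ 4 * Real.pi ^ 2 * (2 * (cν⁻¹ * F)) ^ 2 := mul_le_mul_of_nonneg_left hx0sq hpi.le
      _ = F ^ 2 / ν ^ 2 / Real.pi ^ 2 := by rw [hcν]; field_simp; ring
      _ ≤ F ^ 2 / ν ^ 2 := div_le_self (by positivity) hπ1

end Summit.AnomalousDissipation.AnomalousDissipation.Theorems.RobustLoudUpgrade.LaminarCorner

end
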